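import Mathlib
import HarnessLib
import Summits.MatrixMultiplication.MatrixMultiplication.Theorems.OutsiderSandwichCouplingSubrank

/-!
# OutsiderSandwich — the layer-2 laser-descent items over the route declarations (decomp-mm lens-4, g16)

The route file `Theses/OutsiderSandwich.lean` (rev 23) carries the g16 asides `CouplingDiagonal`
(28252), `CouplingSubrankFull` (28253), `CouplingSubrankOfDiagonal` (28258), `CouplingIsMMNecessary`
(28259) and `SummitIffCouplingIsMM` (28260); the first two spell out the coupling tensor
`C = C₁ ⊠ C₂ ⊠ C₃` verbatim and are definitionally the Props of
`Theorems/OutsiderSandwichCouplingSubrank.lean`.  This file records the definitional bridges and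
closes the three proved asides by name:

* `couplingSubrankOfDiagonal_holds : CouplingSubrankOfDiagonal` — `CouplingDiagonal ⟹
  CouplingSubrankFull` (diagonals `⟨r⟩ ≤ C^{⊠N}`, `r ≥ 64^N 2^{-εN}`, give `64 ≤ F(C)`);
* `couplingIsMMNecessary_holds : CouplingIsMMNecessary` — `CouplingSubrankFull ⟹ ω = 2 ⟹
  CouplingIsMM` (the ω-free leaf `⟨8,8,8⟩ ≲ C` is NECESSARY for the summit);
* `summitIffCouplingIsMM_holds : SummitIffCouplingIsMM` — `CouplingSubrankFull ⟹
  (ω = 2 ⟺ CouplingIsMM ∧ CouplingMergeOptimal)`, the refined equivalence layer of the node.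

The hypothesis `CouplingSubrankFull` (`64 ≤ F(C)` at every universal point) is the spectral shadow
of `Q̃(C) = 64`, Strassen's theorem on the asymptotic subrank of tight sets applied to the support of
`C` (V. Strassen, J. reine angew. Math. 413 (1991); M. Christandl, P. Vrana, J. Zuiddam,
arXiv:1709.07851, Thm. 4.4 / Cor. 4.5); its operational form is `CouplingDiagonal`.
-/

noncomputable section

namespace Summit.MatrixMultiplication.MatrixMultiplication.Theorems.OutsiderSandwichCouplingSubrankItems

open Summit.MatrixMultiplication.MatrixMultiplication

/-! ## 1. Definitional bridges route decl ↔ kernel Prop -/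

/-- Item 28252 `CouplingDiagonal` is definitionally the kernel's `CouplingDiagonal`. -/
theorem couplingDiagonal_iff :
    Theses.OutsiderSandwich.CouplingDiagonal ↔ Theorems.OutsiderSandwichCouplingSubrank.CouplingDiagonal :=
  Iff.rfl

/-- Item 28253 `CouplingSubrankFull` is definitionally the kernel's `CouplingSubrankFull`. -/
theorem couplingSubrankFull_iff :
    Theses.OutsiderSandwich.CouplingSubrankFull ↔
      Theorems.OutsiderSandwichCouplingSubrank.CouplingSubrankFull :=
  Iff.rfl

/-! ## 2. The three proved asides, by name -/

/-- Item 28258: `CouplingDiagonal ⟹ CouplingSubrankFull`. -/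
theorem couplingSubrankOfDiagonal_holds : Theses.OutsiderSandwich.CouplingSubrankOfDiagonal :=
  Theorems.OutsiderSandwichCouplingSubrank.couplingSubrankFull_of_diagonal

/-- Item 28259: `CouplingSubrankFull ⟹ ω = 2 ⟹ CouplingIsMM` — the leaf is necessary. -/
theorem couplingIsMMNecessary_holds : Theses.OutsiderSandwich.CouplingIsMMNecessary :=
  Theorems.OutsiderSandwichCouplingSubrank.couplingIsMM_of_summit

/-- Item 28260: `CouplingSubrankFull ⟹ (ω = 2 ⟺ CouplingIsMM ∧ CouplingMergeOptimal)`. -/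
theorem summitIffCouplingIsMM_holds : Theses.OutsiderSandwich.SummitIffCouplingIsMM :=
  Theorems.OutsiderSandwichCouplingSubrank.summit_iff_couplingIsMM

/-! ## 3. Edges over the route decls -/

/-- `CouplingDiagonal ⟹ ω = 2 ⟹ CouplingIsMM`, over the route decls. -/
theorem couplingIsMM_of_summit_of_couplingDiagonal (hD : Theses.OutsiderSandwich.CouplingDiagonal)
    (hS : _root_.MatrixMultiplication) : Theses.OutsiderSandwich.CouplingIsMM :=
  Theorems.OutsiderSandwichCouplingSubrank.couplingIsMM_of_summit_of_diagonal hD hS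

/-- `CouplingDiagonal ⟹ (ω = 2 ⟺ CouplingIsMM ∧ CouplingMergeOptimal)`, over the route decls. -/
theorem summit_iff_couplingIsMM_of_couplingDiagonal (hD : Theses.OutsiderSandwich.CouplingDiagonal) :
    _root_.MatrixMultiplication ↔
      (Theses.OutsiderSandwich.CouplingIsMM ∧ Theses.OutsiderSandwich.CouplingMergeOptimal) :=
  Theorems.OutsiderSandwichCouplingSubrank.summit_iff_couplingIsMM_of_diagonal hD

/-- Given the spectral floor and the residual, the leaf and the attacked piece coincide:
`CouplingSubrankFull ⟹ CouplingMergeOptimal ⟹ (CouplingIsMM ⟺ CouplingTangency)`. -/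
theorem couplingIsMM_iff_couplingTangency (hQ : Theses.OutsiderSandwich.CouplingSubrankFull)
    (hR : Theses.OutsiderSandwich.CouplingMergeOptimal) :
    Theses.OutsiderSandwich.CouplingIsMM ↔ Theses.OutsiderSandwich.CouplingTangency :=
  Theorems.OutsiderSandwichCouplingSubrank.couplingIsMM_iff_couplingTangency hQ hR

end Summit.MatrixMultiplication.MatrixMultiplication.Theorems.OutsiderSandwichCouplingSubrankItems
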